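import Literature.Analysis.PDE.TorusWordCalculus
import Literature.Analysis.PDE.CoordWordFaaDiBruno
import Literature.Analysis.PDE.SymmetricHyperbolicEnergy
import HarnessLib

/-!
# Sequences of space–time fields on the torus converging uniformly with all spatial word
# derivatives: closure under products, smooth composition and the time-derivative recursion
# (topic `Analysis/PDE`)

Analysis/PDE support file (everything proved; two definitions with bodies, no named facts) of
the energy method for quasilinear symmetric hyperbolic systems on `𝕋³` (Majda 1984, Ch. 2,
proof of Thm 2.1, Step 3; Dafermos 2005, §5.1 (5.1.25)–(5.1.26)), towards the named fact
`Literature.MathematicalPhysics.KineticTheory.hsEuler_localExistence`. The Picard iterates `Uᵏ`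
converge uniformly on `[-T, T] × 𝕋³` together with all SPATIAL derivatives
(`TorusQuasilinearScheme`); to obtain a jointly `C^∞` limit one needs the same for all mixed
space–time derivatives `∂ₜˡ∂^w Uᵏ`, which are polynomial expressions in the iterates through
the equations `∂ₜUᵏ⁺¹ = -Σⱼ ãⱼ(Uᵏ)∂ⱼUᵏ⁺¹`. This file provides the bookkeeping:

* `UnifWords T F` — the sequence `F k` of jointly smooth fields is uniformly Cauchy on
  `[-T, T] × 𝕋ⁿ` in every spatial word derivative; such sequences are uniformly bounded in every
  word (`UnifWords.bounded`) and the class is closed under sums, spatial derivatives, shifts,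
  **continuous bilinear pointwise operations** (`UnifWords.bilin`, Leibniz) and **composition
  with smooth maps of the values** (`UnifWords.comp`, Faà di Bruno through
  `cwd_comp_eq_sum_fdbEval` and uniform continuity of the derivatives of the outer map on
  balls);
* `InB T l F` — the recursion "`F` and its first `l` time derivatives are in the class"
  (`InB T (l+1) F ↔ InB T l F ∧ InB T l (∂ₜF)`), closed under the same operations (product and
  chain rules in time), so that membership of a Picard scheme propagates to all time orders.

## Mathlib / tree search

Tree: `TorusWordCalculus` (dictionary, Leibniz), `CoordWordFaaDiBruno` (`fdbTerms`, `fdbEval`,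
`cwd_comp_eq_sum_fdbEval`), `wordsLE` (`SymmetricHyperbolicEnergy`),
`Torus.IsSmoothSpaceTimeOn.exists_norm_le_of_isCompact` (`TorusSpaceTime`). Mathlib:
`ContinuousMultilinearMap.norm_image_sub_le`, `IsCompact.uniformContinuousOn_of_continuous`,
`ContDiff.continuous_iteratedFDeriv`.

## References

* A. Majda, *Compressible Fluid Flow and Systems of Conservation Laws in Several Space
  Variables*, Springer 1984, Ch. 2 §2.1, proof of Thm 2.1, Step 3. [`Majda1984`]
* C. M. Dafermos, *Hyperbolic Conservation Laws in Continuum Physics*, 2nd ed., Springer 2005,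
  §5.1, proof of Thm 5.1.1, (5.1.25)–(5.1.26). [`Dafermos2005`]
-/

noncomputable section

open Set Filter Function
open scoped ContDiff Topology

namespace Literature.Analysis.PDE

open Literature.Analysis.FunctionSpaces Literature.Analysis.FunctionSpaces.Torus

universe u

variable {ι : Type*} [Fintype ι] [DecidableEq ι]
variable {X Y Z : Type*} [NormedAddCommGroup X] [NormedSpace ℝ X] [NormedAddCommGroup Y]
  [NormedSpace ℝ Y] [NormedAddCommGroup Z] [NormedSpace ℝ Z]

/-! ## Small tools -/

omit [DecidableEq ι] in
/-- Time slices of a field jointly smooth on `ℝ × 𝕋ⁿ` are differentiable in time (copy of the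
tool of `TorusQuasilinearAPriori`, not imported here). [folklore] -/
theorem hasDerivAt_slice_of_univ' {u : ℝ → UnitAddTorus ι → X} (hu : IsSmoothSpaceTimeOn univ u)
    (t : ℝ) (x : UnitAddTorus ι) : HasDerivAt (fun τ => u τ x) (timeDeriv u t x) t := by
  have h := (hu.hasDerivWithinAt_slice (mem_univ t) x).hasDerivAt Filter.univ_mem
  have e : timeDerivWithin univ u t x = timeDeriv u t x :=
    congr_fun (derivWithin_univ (f := fun τ => u τ x)) t
  rwa [e] at h

omit [NormedSpace ℝ X] in
/-- List sums: `‖Σ f - Σ g‖ ≤ |l| · C` if `‖f a - g a‖ ≤ C` termwise. [folklore] -/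
theorem norm_sum_map_sub_le {α : Type*} (l : List α) (f g : α → X) {C : ℝ}
    (h : ∀ a ∈ l, ‖f a - g a‖ ≤ C) : ‖(l.map f).sum - (l.map g).sum‖ ≤ l.length * C := by
  induction l with
  | nil => simp
  | cons a l ih =>
    simp only [List.map_cons, List.sum_cons, List.length_cons, Nat.cast_add, Nat.cast_one]
    have h1 := h a List.mem_cons_self
    have h2 := ih fun b hb => h b (List.mem_cons_of_mem _ hb)
    calc ‖f a + (l.map f).sum - (g a + (l.map g).sum)‖
        = ‖(f a - g a) + ((l.map f).sum - (l.map g).sum)‖ := by abel_nf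
      _ ≤ ‖f a - g a‖ + ‖(l.map f).sum - (l.map g).sum‖ := norm_add_le _ _
      _ ≤ C + l.length * C := add_le_add h1 h2
      _ = (l.length + 1) * C := by ring

/-- **Leibniz expansion on the torus for a continuous bilinear operation**:
`∂^w B(f, g) = Σ_{(a,c) ∈ splittings w} B(∂^a f, ∂^c g)`. [cite: Evans2010, App. C.2] -/
theorem iterPartialDeriv_bilinear (B : X →L[ℝ] Y →L[ℝ] Z) {f : UnitAddTorus ι → X}
    {g : UnitAddTorus ι → Y} (hf : IsSmooth f) (hg : IsSmooth g) (w : List ι) :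
    iterPartialDeriv w (fun x => B (f x) (g x)) = fun x =>
      ((splittings w).map fun p => B (iterPartialDeriv p.1 f x) (iterPartialDeriv p.2 g x)).sum := by
  have hfg : IsSmooth fun x => B (f x) (g x) :=
    B.isBoundedBilinearMap.contDiff.comp (hf.prodMk hg)
  apply lift_injective
  rw [lift_iterPartialDeriv_eq_cwd hfg w]
  have h := cwd_bilinear B hf hg w
  have e1 : lift (fun x => B (f x) (g x)) = fun y => B (lift f y) (lift g y) := rfl
  rw [e1, h]
  funext y
  rw [lift_apply]
  congr 1
  refine List.map_congr_left fun p _ => ?_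
  rw [iterPartialDeriv_apply_proj hf, iterPartialDeriv_apply_proj hg]

/-! ## The class -/

/-- **Sequences of jointly smooth fields on `ℝ × 𝕋ⁿ` which are uniformly Cauchy on
`[-T, T] × 𝕋ⁿ` in every spatial word derivative.** [cite: Majda1984, Ch. 2 §2.1, proof of Thm 2.1, Step 3] -/
def UnifWords (T : ℝ) (F : ℕ → ℝ → UnitAddTorus ι → X) : Prop :=
  (∀ k, IsSmoothSpaceTimeOn univ (F k)) ∧
    ∀ (w : List ι) (ε : ℝ), 0 < ε → ∃ N : ℕ, ∀ k, N ≤ k → ∀ l, N ≤ l → ∀ t ∈ Icc (-T) T, ∀ x,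
      ‖iterPartialDeriv w (F k t) x - iterPartialDeriv w (F l t) x‖ ≤ ε

namespace UnifWords

variable {T : ℝ} {F : ℕ → ℝ → UnitAddTorus ι → X} {G : ℕ → ℝ → UnitAddTorus ι → Y}

/-- Members are jointly smooth. [folklore] -/
theorem smooth (h : UnifWords T F) (k : ℕ) : IsSmoothSpaceTimeOn univ (F k) := h.1 k

/-- Slices of members are smooth. [folklore] -/
theorem isSmooth (h : UnifWords T F) (k : ℕ) (t : ℝ) : IsSmooth (F k t) :=
  (h.1 k).isSmooth_slice (mem_univ t)

/-- The Cauchy property. [folklore] -/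
theorem cauchy (h : UnifWords T F) (w : List ι) {ε : ℝ} (hε : 0 < ε) :
    ∃ N : ℕ, ∀ k, N ≤ k → ∀ l, N ≤ l → ∀ t ∈ Icc (-T) T, ∀ x,
      ‖iterPartialDeriv w (F k t) x - iterPartialDeriv w (F l t) x‖ ≤ ε :=
  h.2 w ε hε

/-- **Uniform bounds**: every word derivative of a member sequence is bounded on
`[-T, T] × 𝕋ⁿ`, uniformly in `k`. [folklore] -/
theorem bounded (h : UnifWords T F) (w : List ι) :
    ∃ R : ℝ, 0 ≤ R ∧ ∀ k, ∀ t ∈ Icc (-T) T, ∀ x, ‖iterPartialDeriv w (F k t) x‖ ≤ R := by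
  obtain ⟨N, hN⟩ := h.cauchy w one_pos
  have hb : ∀ k, ∃ C : ℝ, ∀ t ∈ Icc (-T) T, ∀ x, ‖iterPartialDeriv w (F k t) x‖ ≤ C := fun k =>
    (isSmoothSpaceTimeOn_iterPartialDeriv (h.smooth k) uniqueDiffOn_univ w).exists_norm_le_of_isCompact
      isCompact_Icc (subset_univ _)
  choose C hC using hb
  refine ⟨(∑ k ∈ Finset.range (N + 1), |C k|) + 1, by positivity, fun k t ht x => ?_⟩
  have hsum : ∀ j, j ≤ N → |C j| ≤ ∑ k ∈ Finset.range (N + 1), |C k| := fun j hj =>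
    Finset.single_le_sum (f := fun k => |C k|) (fun k _ => abs_nonneg _)
      (Finset.mem_range.2 (Nat.lt_succ_of_le hj))
  by_cases hk : k ≤ N
  · calc ‖iterPartialDeriv w (F k t) x‖ ≤ C k := hC k t ht x
      _ ≤ |C k| := le_abs_self _
      _ ≤ _ := by linarith [hsum k hk]
  · push Not at hk
    have h1 := hN k hk.le N le_rfl t ht x
    have h2 := hC N t ht x
    calc ‖iterPartialDeriv w (F k t) x‖
        ≤ ‖iterPartialDeriv w (F k t) x - iterPartialDeriv w (F N t) x‖ +
          ‖iterPartialDeriv w (F N t) x‖ := norm_le_norm_sub_add _ _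
      _ ≤ 1 + |C N| := add_le_add h1 (h2.trans (le_abs_self _))
      _ ≤ _ := by linarith [hsum N le_rfl]

/-- Shifts. [folklore] -/
theorem shift (h : UnifWords T F) : UnifWords T (fun k => F (k + 1)) := by
  refine ⟨fun k => h.smooth (k + 1), fun w ε hε => ?_⟩
  obtain ⟨N, hN⟩ := h.cauchy w hε
  exact ⟨N, fun k hk l hl => hN (k + 1) (by omega) (l + 1) (by omega)⟩

/-- Unshifts. [folklore] -/
theorem of_shift (h0 : IsSmoothSpaceTimeOn univ (F 0)) (h : UnifWords T (fun k => F (k + 1))) :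
    UnifWords T F := by
  refine ⟨fun k => ?_, fun w ε hε => ?_⟩
  · cases k with
    | zero => exact h0
    | succ k => exact h.smooth k
  · obtain ⟨N, hN⟩ := h.cauchy w hε
    refine ⟨N + 1, fun k hk l hl t ht x => ?_⟩
    obtain ⟨k', rfl⟩ := Nat.exists_eq_add_of_le' (Nat.one_le_iff_ne_zero.2 (by omega) : 1 ≤ k)
    obtain ⟨l', rfl⟩ := Nat.exists_eq_add_of_le' (Nat.one_le_iff_ne_zero.2 (by omega) : 1 ≤ l)
    exact hN k' (by omega) l' (by omega) t ht x

/-- Negation. [folklore] -/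
theorem neg (h : UnifWords T F) : UnifWords T (fun k t x => -F k t x) := by
  refine ⟨fun k => (h.smooth k).neg, fun w ε hε => ?_⟩
  obtain ⟨N, hN⟩ := h.cauchy w hε
  refine ⟨N, fun k hk l hl t ht x => ?_⟩
  have e : ∀ k, iterPartialDeriv w (fun x => -F k t x) = fun x => (-1 : ℝ) • iterPartialDeriv w (F k t) x := by
    intro k
    rw [← iterPartialDeriv_const_smul (h.isSmooth k t) (-1) w]
    simp
  rw [e k, e l]
  calc ‖(-1 : ℝ) • iterPartialDeriv w (F k t) x - (-1 : ℝ) • iterPartialDeriv w (F l t) x‖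
      = ‖iterPartialDeriv w (F k t) x - iterPartialDeriv w (F l t) x‖ := by
        rw [← smul_sub, norm_smul]; simp
    _ ≤ ε := hN k hk l hl t ht x

/-- Sums. [folklore] -/
theorem add {F' : ℕ → ℝ → UnitAddTorus ι → X} (h : UnifWords T F) (h' : UnifWords T F') :
    UnifWords T (fun k t x => F k t x + F' k t x) := by
  refine ⟨fun k => (h.smooth k).add (h'.smooth k), fun w ε hε => ?_⟩
  obtain ⟨N, hN⟩ := h.cauchy w (half_pos hε)
  obtain ⟨N', hN'⟩ := h'.cauchy w (half_pos hε)
  refine ⟨max N N', fun k hk l hl t ht x => ?_⟩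
  rw [iterPartialDeriv_add (h.isSmooth k t) (h'.isSmooth k t) w,
    iterPartialDeriv_add (h.isSmooth l t) (h'.isSmooth l t) w]
  have h1 := hN k ((le_max_left _ _).trans hk) l ((le_max_left _ _).trans hl) t ht x
  have h2 := hN' k ((le_max_right _ _).trans hk) l ((le_max_right _ _).trans hl) t ht x
  dsimp only
  calc _ = ‖(iterPartialDeriv w (F k t) x - iterPartialDeriv w (F l t) x) +
        (iterPartialDeriv w (F' k t) x - iterPartialDeriv w (F' l t) x)‖ := by congr 1; abel
    _ ≤ _ := norm_add_le _ _
    _ ≤ ε / 2 + ε / 2 := add_le_add h1 h2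
    _ = ε := by ring

/-- Finite sums. [folklore] -/
theorem sum {κ : Type*} (s : Finset κ) {F : κ → ℕ → ℝ → UnitAddTorus ι → X}
    (h : ∀ i ∈ s, UnifWords T (F i)) : UnifWords T (fun k t x => ∑ i ∈ s, F i k t x) := by
  classical
  induction s using Finset.induction_on with
  | empty =>
    refine ⟨fun k => ?_, fun w ε hε => ⟨0, fun k _ l _ t _ x => ?_⟩⟩
    · simp only [Finset.sum_empty]
      exact isSmoothSpaceTimeOn_const (F := X) (by
        show ContDiff ℝ ∞ (lift fun _ : UnitAddTorus ι => (0 : X)); exact contDiff_const) univ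
    · simp only [Finset.sum_empty]
      rw [show (fun _ : UnitAddTorus ι => (0 : X)) = fun _ => (0 : ℝ) • (0 : X) by simp,
        iterPartialDeriv_const_smul (by show ContDiff ℝ ∞ (lift fun _ : UnitAddTorus ι => (0 : X)); exact contDiff_const) 0 w]
      simpa using hε.le
  | insert a s ha ih =>
    simp only [Finset.sum_insert ha]
    exact (h a (Finset.mem_insert_self a s)).add (ih fun i hi => h i (Finset.mem_insert_of_mem hi))

/-- Spatial derivatives. [folklore] -/
theorem partialDeriv (h : UnifWords T F) (j : ι) :
    UnifWords T (fun k t x => Torus.partialDeriv j (F k t) x) := by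
  refine ⟨fun k => (h.smooth k).partialDeriv uniqueDiffOn_univ j, fun w ε hε => ?_⟩
  obtain ⟨N, hN⟩ := h.cauchy (w ++ [j]) hε
  refine ⟨N, fun k hk l hl t ht x => ?_⟩
  have e : ∀ k, iterPartialDeriv w (fun x => Torus.partialDeriv j (F k t) x) =
      iterPartialDeriv (w ++ [j]) (F k t) := fun k => (iterPartialDeriv_concat w j (F k t)).symm
  rw [e k, e l]
  exact hN k hk l hl t ht x

/-- **Continuous bilinear pointwise operations** preserve the class (Leibniz expansion; each
term is a product of a uniformly bounded and a uniformly Cauchy factor). [folklore] -/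
theorem bilin (B : X →L[ℝ] Y →L[ℝ] Z) (hF : UnifWords T F) (hG : UnifWords T G) :
    UnifWords T (fun k t x => B (F k t x) (G k t x)) := by
  refine ⟨fun k => ?_, fun w ε hε => ?_⟩
  · exact B.isBoundedBilinearMap.contDiff.comp_contDiffOn ((hF.smooth k).prodMk (hG.smooth k))
  -- bounds for all words of length ≤ |w|
  choose RF hRF0 hRF using fun a : List ι => hF.bounded a
  choose RG hRG0 hRG using fun c : List ι => hG.bounded c
  set R : ℝ := (∑ a ∈ wordsLE ι w.length, RF a) + (∑ c ∈ wordsLE ι w.length, RG c) + 1 with hR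
  have hR1 : 1 ≤ R := by
    have := Finset.sum_nonneg fun a (_ : a ∈ wordsLE ι w.length) => hRF0 a
    have := Finset.sum_nonneg fun c (_ : c ∈ wordsLE ι w.length) => hRG0 c
    linarith
  have hRFle : ∀ a ∈ wordsLE ι w.length, RF a ≤ R := fun a ha => by
    have := Finset.single_le_sum (f := RF) (fun a _ => hRF0 a) ha
    have := Finset.sum_nonneg fun c (_ : c ∈ wordsLE ι w.length) => hRG0 c
    linarith
  have hRGle : ∀ c ∈ wordsLE ι w.length, RG c ≤ R := fun c hc => by
    have := Finset.single_le_sum (f := RG) (fun c _ => hRG0 c) hc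
    have := Finset.sum_nonneg fun a (_ : a ∈ wordsLE ι w.length) => hRF0 a
    linarith
  -- Cauchy indices for all words of length ≤ |w|
  set K : ℝ := 2 ^ w.length * (‖B‖ + 1) * R + 1 with hK
  have hK0 : 0 < K := by positivity
  have hη : 0 < ε / (2 * K) := by positivity
  choose NF hNF using fun a : List ι => hF.cauchy a hη
  choose NG hNG using fun c : List ι => hG.cauchy c hη
  refine ⟨(wordsLE ι w.length).sup NF ⊔ (wordsLE ι w.length).sup NG, fun k hk l hl t ht x => ?_⟩
  rw [iterPartialDeriv_bilinear B (hF.isSmooth k t) (hG.isSmooth k t) w,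
    iterPartialDeriv_bilinear B (hF.isSmooth l t) (hG.isSmooth l t) w]
  have hterm : ∀ p ∈ splittings w,
      ‖B (iterPartialDeriv p.1 (F k t) x) (iterPartialDeriv p.2 (G k t) x) -
        B (iterPartialDeriv p.1 (F l t) x) (iterPartialDeriv p.2 (G l t) x)‖ ≤
        2 * (‖B‖ + 1) * R * (ε / (2 * K)) := by
    intro p hp
    have hlen := length_add_length_of_mem_splittings hp
    have ha : p.1 ∈ wordsLE ι w.length := mem_wordsLE.2 (by omega)
    have hc : p.2 ∈ wordsLE ι w.length := mem_wordsLE.2 (by omega)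
    have hkF : NF p.1 ≤ k := ((Finset.le_sup ha).trans le_sup_left).trans hk
    have hlF : NF p.1 ≤ l := ((Finset.le_sup ha).trans le_sup_left).trans hl
    have hkG : NG p.2 ≤ k := ((Finset.le_sup hc).trans le_sup_right).trans hk
    have hlG : NG p.2 ≤ l := ((Finset.le_sup hc).trans le_sup_right).trans hl
    set f₁ := iterPartialDeriv p.1 (F k t) x
    set f₂ := iterPartialDeriv p.1 (F l t) x
    set g₁ := iterPartialDeriv p.2 (G k t) x
    set g₂ := iterPartialDeriv p.2 (G l t) x
    have e : B f₁ g₁ - B f₂ g₂ = B (f₁ - f₂) g₁ + B f₂ (g₁ - g₂) := by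
      simp only [map_sub, FunLike.coe_sub, Pi.sub_apply]; abel
    rw [e]
    have hB1 : ‖B (f₁ - f₂) g₁‖ ≤ ‖B‖ * ‖f₁ - f₂‖ * ‖g₁‖ := B.le_opNorm₂ _ _
    have hB2 : ‖B f₂ (g₁ - g₂)‖ ≤ ‖B‖ * ‖f₂‖ * ‖g₁ - g₂‖ := B.le_opNorm₂ _ _
    have h1 : ‖f₁ - f₂‖ ≤ ε / (2 * K) := hNF p.1 k hkF l hlF t ht x
    have h2 : ‖g₁ - g₂‖ ≤ ε / (2 * K) := hNG p.2 k hkG l hlG t ht x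
    have h3 : ‖g₁‖ ≤ R := (hRG p.2 k t ht x).trans (hRGle p.2 hc)
    have h4 : ‖f₂‖ ≤ R := (hRF p.1 l t ht x).trans (hRFle p.1 ha)
    have hBn : 0 ≤ ‖B‖ := norm_nonneg B
    calc _ ≤ ‖B (f₁ - f₂) g₁‖ + ‖B f₂ (g₁ - g₂)‖ := norm_add_le _ _
      _ ≤ ‖B‖ * (ε / (2 * K)) * R + ‖B‖ * R * (ε / (2 * K)) := by
          refine add_le_add (hB1.trans ?_) (hB2.trans ?_)
          · exact mul_le_mul (mul_le_mul_of_nonneg_left h1 hBn) h3 (norm_nonneg _) (by positivity)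
          · exact mul_le_mul (mul_le_mul_of_nonneg_left h4 hBn) h2 (norm_nonneg _) (by positivity)
      _ ≤ 2 * (‖B‖ + 1) * R * (ε / (2 * K)) := by nlinarith [hη.le, hR1]
  calc _ ≤ (splittings w).length * (2 * (‖B‖ + 1) * R * (ε / (2 * K))) := norm_sum_map_sub_le _ _ _ hterm
    _ = 2 ^ w.length * (2 * (‖B‖ + 1) * R * (ε / (2 * K))) := by rw [length_splittings]; norm_cast
    _ = ε * ((2 ^ w.length * (‖B‖ + 1) * R) / K) := by field_simp
    _ ≤ ε * 1 := by
        refine mul_le_mul_of_nonneg_left ?_ hε.le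
        rw [div_le_one hK0, hK]; linarith
    _ = ε := mul_one ε

/-- **Composition with smooth maps of the values** preserves the class (Faà di Bruno expansion
`cwd_comp_eq_sum_fdbEval`; the derivatives of the outer map are uniformly continuous on the ball
containing all values). [folklore] -/
theorem comp {W : Type u} [NormedAddCommGroup W] [NormedSpace ℝ W] [FiniteDimensional ℝ W]
    {X' : Type u} [NormedAddCommGroup X'] [NormedSpace ℝ X']
    {F : ℕ → ℝ → UnitAddTorus ι → W} {φ : W → X'} (hφ : ContDiff ℝ ∞ φ) (hF : UnifWords T F) :
    UnifWords T (fun k t x => φ (F k t x)) := by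
  refine ⟨fun k => hφ.comp_contDiffOn (hF.smooth k), fun w ε hε => ?_⟩
  set n := w.length with hn
  -- uniform bounds on the words of `F` of length ≤ n, and on the values
  choose RF hRF0 hRF using fun a : List ι => hF.bounded a
  set R : ℝ := (∑ a ∈ wordsLE ι n, RF a) + 1 with hR
  have hR1 : 1 ≤ R := by
    have := Finset.sum_nonneg fun a (_ : a ∈ wordsLE ι n) => hRF0 a
    linarith
  have hR0 : 0 ≤ R := by linarith
  have hRle : ∀ a ∈ wordsLE ι n, RF a ≤ R := fun a ha => by
    have := Finset.single_le_sum (f := RF) (fun a _ => hRF0 a) ha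
    linarith
  have hval : ∀ k, ∀ t ∈ Icc (-T) T, ∀ x, F k t x ∈ Metric.closedBall (0 : W) R := by
    intro k t ht x
    rw [Metric.mem_closedBall, dist_zero_right]
    have := hRF [] k t ht x
    exact (by simpa using this : ‖F k t x‖ ≤ RF []).trans (hRle [] (nil_mem_wordsLE n))
  -- the derivatives of `φ` up to order `n`, jointly, on the ball
  set Φ : W → (Π r : Fin (n + 1), W [×(r : ℕ)]→L[ℝ] X') := fun u r => iteratedFDeriv ℝ r φ u with hΦ
  have hΦc : Continuous Φ := continuous_pi fun r => hφ.continuous_iteratedFDeriv (by exact_mod_cast le_top)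
  have hball : IsCompact (Metric.closedBall (0 : W) R) := isCompact_closedBall 0 R
  obtain ⟨CΦ, hCΦ⟩ := hball.exists_bound_of_continuousOn hΦc.continuousOn
  set C : ℝ := max CΦ 0 + 1 with hC
  have hC0 : 0 < C := by positivity
  have hCr : ∀ u ∈ Metric.closedBall (0 : W) R, ∀ r : Fin (n + 1), ‖iteratedFDeriv ℝ r φ u‖ ≤ C := by
    intro u hu r
    calc ‖iteratedFDeriv ℝ r φ u‖ = ‖Φ u r‖ := rfl
      _ ≤ ‖Φ u‖ := norm_le_pi_norm _ r
      _ ≤ CΦ := hCΦ u hu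
      _ ≤ C := by rw [hC]; linarith [le_max_left CΦ 0]
  have hΦu := hball.uniformContinuousOn_of_continuous hΦc.continuousOn
  -- sizes
  set L : ℝ := (n.factorial : ℝ) * R ^ n + 1 with hL
  have hL0 : 0 < L := by positivity
  set η : ℝ := ε / (2 * L) with hη
  have hη0 : 0 < η := by positivity
  set η' : ℝ := ε / (2 * L * (C * n + 1)) with hη'
  have hη'0 : 0 < η' := by positivity
  -- modulus of continuity of `Φ`
  obtain ⟨δ, hδ0, hδ⟩ := Metric.uniformContinuousOn_iff.1 hΦu η hη0
  -- indices
  choose NF hNF using fun a : List ι => hF.cauchy a hη'0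
  obtain ⟨N0, hN0⟩ := hF.cauchy [] (half_pos hδ0)
  refine ⟨(wordsLE ι n).sup NF ⊔ N0, fun k hk l hl t ht x => ?_⟩
  have hk0 : N0 ≤ k := le_sup_right.trans hk
  have hl0 : N0 ≤ l := le_sup_right.trans hl
  -- pass to the lifted picture
  have hVk : ContDiff ℝ ∞ (lift (F k t)) := hF.isSmooth k t
  have hVl : ContDiff ℝ ∞ (lift (F l t)) := hF.isSmooth l t
  have hck : IsSmooth fun y => φ (F k t y) := isSmooth_comp hφ (hF.isSmooth k t)
  have hcl : IsSmooth fun y => φ (F l t y) := isSmooth_comp hφ (hF.isSmooth l t)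
  obtain ⟨y, rfl⟩ := proj_surjective x
  rw [iterPartialDeriv_apply_proj hck, iterPartialDeriv_apply_proj hcl]
  have ek : lift (fun y => φ (F k t y)) = φ ∘ lift (F k t) := rfl
  have el : lift (fun y => φ (F l t y)) = φ ∘ lift (F l t) := rfl
  rw [ek, el, cwd_comp_eq_sum_fdbEval hφ hVk w y, cwd_comp_eq_sum_fdbEval hφ hVl w y]
  -- termwise estimate
  have hterm : ∀ T' ∈ fdbTerms w, ‖fdbEval φ (lift (F k t)) T' y - fdbEval φ (lift (F l t)) T' y‖ ≤
      R ^ n * (η + C * n * η') := by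
    intro T' hT'
    have hr : T'.1 ≤ n := fst_le_length_of_mem_fdbTerms hT'
    set r := T'.1 with hrdef
    set M₁ := iteratedFDeriv ℝ r φ (lift (F k t) y) with hM₁
    set M₂ := iteratedFDeriv ℝ r φ (lift (F l t) y) with hM₂
    set v₁ : Fin r → W := fun j => cwd (T'.2 j) (lift (F k t)) y with hv₁
    set v₂ : Fin r → W := fun j => cwd (T'.2 j) (lift (F l t)) y with hv₂
    change ‖M₁ v₁ - M₂ v₂‖ ≤ _
    -- bounds on the tuples
    have hwj : ∀ j : Fin r, T'.2 j ∈ wordsLE ι n := fun j =>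
      mem_wordsLE.2 ((length_le_of_mem_fdbTerms hT' j).trans le_rfl)
    have hv₁b : ∀ j, ‖v₁ j‖ ≤ R := fun j => by
      rw [hv₁]; simp only
      rw [← iterPartialDeriv_apply_proj (hF.isSmooth k t)]
      exact (hRF _ k t ht _).trans (hRle _ (hwj j))
    have hv₂b : ∀ j, ‖v₂ j‖ ≤ R := fun j => by
      rw [hv₂]; simp only
      rw [← iterPartialDeriv_apply_proj (hF.isSmooth l t)]
      exact (hRF _ l t ht _).trans (hRle _ (hwj j))
    have hv₁n : ‖v₁‖ ≤ R := (pi_norm_le_iff_of_nonneg hR0).2 hv₁b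
    have hv₂n : ‖v₂‖ ≤ R := (pi_norm_le_iff_of_nonneg hR0).2 hv₂b
    have hdv : ‖v₁ - v₂‖ ≤ η' := by
      refine (pi_norm_le_iff_of_nonneg hη'0.le).2 fun j => ?_
      simp only [Pi.sub_apply, hv₁, hv₂]
      rw [← iterPartialDeriv_apply_proj (hF.isSmooth k t), ← iterPartialDeriv_apply_proj (hF.isSmooth l t)]
      have hkj : NF (T'.2 j) ≤ k := ((Finset.le_sup (hwj j)).trans le_sup_left).trans hk
      have hlj : NF (T'.2 j) ≤ l := ((Finset.le_sup (hwj j)).trans le_sup_left).trans hl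
      exact hNF _ k hkj l hlj t ht _
    -- bounds on the multilinear maps
    have hyk : lift (F k t) y ∈ Metric.closedBall (0 : W) R := by
      rw [lift_apply]; exact hval k t ht _
    have hyl : lift (F l t) y ∈ Metric.closedBall (0 : W) R := by
      rw [lift_apply]; exact hval l t ht _
    have hM₂n : ‖M₂‖ ≤ C := hCr _ hyl ⟨r, Nat.lt_succ_of_le hr⟩
    have hdM : ‖M₁ - M₂‖ ≤ η := by
      have hdist : dist (lift (F k t) y) (lift (F l t) y) < δ := by
        rw [dist_eq_norm, lift_apply, lift_apply]
        have := hN0 k hk0 l hl0 t ht (proj y)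
        simp only [iterPartialDeriv_nil] at this
        linarith
      have h1 := hδ _ hyk _ hyl hdist
      rw [dist_eq_norm] at h1
      have h2 : ‖Φ (lift (F k t) y) ⟨r, Nat.lt_succ_of_le hr⟩ - Φ (lift (F l t) y) ⟨r, Nat.lt_succ_of_le hr⟩‖ ≤
          ‖Φ (lift (F k t) y) - Φ (lift (F l t) y)‖ := by
        rw [← Pi.sub_apply]; exact norm_le_pi_norm _ _
      exact (h2.trans h1.le)
    -- assemble
    have hprod : ∏ j, ‖v₁ j‖ ≤ R ^ n := by
      calc ∏ j, ‖v₁ j‖ ≤ ∏ _j : Fin r, R := Finset.prod_le_prod (fun j _ => norm_nonneg _) fun j _ => hv₁b j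
        _ = R ^ r := by simp
        _ ≤ R ^ n := pow_le_pow_right₀ hR1 hr
    have hmax : max ‖v₁‖ ‖v₂‖ ^ (Fintype.card (Fin r) - 1) ≤ R ^ n := by
      have hm : max ‖v₁‖ ‖v₂‖ ≤ R := max_le hv₁n hv₂n
      calc max ‖v₁‖ ‖v₂‖ ^ (Fintype.card (Fin r) - 1) ≤ R ^ (Fintype.card (Fin r) - 1) :=
            pow_le_pow_left₀ (le_max_of_le_left (norm_nonneg _)) hm _
        _ ≤ R ^ n := pow_le_pow_right₀ hR1 (by simp; omega)
    calc ‖M₁ v₁ - M₂ v₂‖ ≤ ‖M₁ v₁ - M₂ v₁‖ + ‖M₂ v₁ - M₂ v₂‖ := norm_sub_le_norm_sub_add_norm_sub _ _ _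
      _ ≤ ‖M₁ - M₂‖ * ∏ j, ‖v₁ j‖ + ‖M₂‖ * Fintype.card (Fin r) * max ‖v₁‖ ‖v₂‖ ^ (Fintype.card (Fin r) - 1) * ‖v₁ - v₂‖ := by
          refine add_le_add ?_ (M₂.norm_image_sub_le v₁ v₂)
          have e : M₁ v₁ - M₂ v₁ = (M₁ - M₂) v₁ := by simp
          rw [e]
          exact (M₁ - M₂).le_opNorm v₁
      _ ≤ η * R ^ n + C * n * R ^ n * η' := by
          have hcard : (Fintype.card (Fin r) : ℝ) ≤ n := by simp; exact_mod_cast hr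
          have h2 : ‖M₂‖ * Fintype.card (Fin r) * max ‖v₁‖ ‖v₂‖ ^ (Fintype.card (Fin r) - 1) * ‖v₁ - v₂‖ ≤
              C * n * R ^ n * η' :=
            mul_le_mul (mul_le_mul (mul_le_mul hM₂n hcard (by positivity) hC0.le) hmax
              (by positivity) (by positivity)) hdv (norm_nonneg _) (by positivity)
          exact add_le_add (mul_le_mul hdM hprod (Finset.prod_nonneg fun j _ => norm_nonneg _) hη0.le) h2
      _ = R ^ n * (η + C * n * η') := by ring
  have hlen : ((fdbTerms w).length : ℝ) ≤ n.factorial := by exact_mod_cast length_fdbTerms_le_factorial w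
  calc _ ≤ (fdbTerms w).length * (R ^ n * (η + C * n * η')) := norm_sum_map_sub_le _ _ _ hterm
    _ ≤ n.factorial * (R ^ n * (η + C * n * η')) := mul_le_mul_of_nonneg_right hlen (by positivity)
    _ ≤ L * (η + C * n * η') := by
        rw [← mul_assoc]
        refine mul_le_mul_of_nonneg_right ?_ (by positivity)
        rw [hL]; linarith
    _ ≤ L * (ε / (2 * L) + ε / (2 * L)) := by
        refine mul_le_mul_of_nonneg_left (add_le_add (le_of_eq hη) ?_) hL0.le
        have h1 : C * n * η' ≤ (C * n + 1) * η' := by nlinarith [hη'0.le]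
        have h2 : (C * n + 1) * η' = ε / (2 * L) := by
          rw [hη']; field_simp
        linarith
    _ = ε := by field_simp; ring

end UnifWords

/-! ## Time derivatives of products and composites -/

section TimeDeriv

variable {F : ℝ → UnitAddTorus ι → X} {G : ℝ → UnitAddTorus ι → Y}

omit [DecidableEq ι] in
/-- **Product rule in time** for a continuous bilinear operation. [folklore] -/
theorem timeDeriv_bilin (B : X →L[ℝ] Y →L[ℝ] Z) (hF : IsSmoothSpaceTimeOn univ F)
    (hG : IsSmoothSpaceTimeOn univ G) :
    timeDeriv (fun t x => B (F t x) (G t x)) =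
      fun t x => B (timeDeriv F t x) (G t x) + B (F t x) (timeDeriv G t x) := by
  funext t x
  have h1 : HasDerivAt (fun τ => B (F τ x)) (B (timeDeriv F t x)) t :=
    B.hasFDerivAt.comp_hasDerivAt t (hasDerivAt_slice_of_univ' hF t x)
  have h2 := h1.clm_apply (hasDerivAt_slice_of_univ' hG t x)
  rw [Torus.timeDeriv, h2.deriv, add_comm]

omit [DecidableEq ι] in
/-- **Chain rule in time** for composition with a smooth map of the values. [folklore] -/
theorem timeDeriv_comp_smooth {W X' : Type*} [NormedAddCommGroup W] [NormedSpace ℝ W]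
    [NormedAddCommGroup X'] [NormedSpace ℝ X'] {F : ℝ → UnitAddTorus ι → W} {φ : W → X'}
    (hφ : ContDiff ℝ ∞ φ) (hF : IsSmoothSpaceTimeOn univ F) :
    timeDeriv (fun t x => φ (F t x)) = fun t x => fderiv ℝ φ (F t x) (timeDeriv F t x) := by
  funext t x
  have h1 : HasDerivAt (fun τ => φ (F τ x)) (fderiv ℝ φ (F t x) (timeDeriv F t x)) t :=
    ((hφ.differentiable (by simp)).differentiableAt.hasFDerivAt).comp_hasDerivAt t
      (hasDerivAt_slice_of_univ' hF t x)
  exact h1.deriv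

omit [DecidableEq ι] in
/-- Time derivative of a sum. [folklore] -/
theorem timeDeriv_add' {F' : ℝ → UnitAddTorus ι → X} (hF : IsSmoothSpaceTimeOn univ F)
    (hF' : IsSmoothSpaceTimeOn univ F') :
    timeDeriv (fun t x => F t x + F' t x) = fun t x => timeDeriv F t x + timeDeriv F' t x := by
  funext t x
  exact ((hasDerivAt_slice_of_univ' hF t x).add (hasDerivAt_slice_of_univ' hF' t x)).deriv

omit [Fintype ι] [DecidableEq ι] in
/-- Time derivative of a negative. [folklore] -/
theorem timeDeriv_neg' (F : ℝ → UnitAddTorus ι → X) :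
    timeDeriv (fun t x => -F t x) = fun t x => -timeDeriv F t x := by
  funext t x
  simp only [Torus.timeDeriv]
  exact deriv.neg

omit [DecidableEq ι] in
/-- Time derivative of a finite sum. [folklore] -/
theorem timeDeriv_sum' {κ : Type*} (s : Finset κ) {F : κ → ℝ → UnitAddTorus ι → X}
    (hF : ∀ i ∈ s, IsSmoothSpaceTimeOn univ (F i)) :
    timeDeriv (fun t x => ∑ i ∈ s, F i t x) = fun t x => ∑ i ∈ s, timeDeriv (F i) t x := by
  funext t x
  exact (HasDerivAt.fun_sum fun i hi => hasDerivAt_slice_of_univ' (hF i hi) t x).deriv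

/-- Time derivative of a spatial derivative. [folklore] -/
theorem timeDeriv_partialDeriv' (hF : IsSmoothSpaceTimeOn univ F) (j : ι) :
    timeDeriv (fun t x => Torus.partialDeriv j (F t) x) = fun t x => Torus.partialDeriv j (timeDeriv F t) x := by
  funext t x
  exact timeDeriv_partialDeriv_comm hF j t x

end TimeDeriv

/-! ## The time-derivative recursion -/

/-- **`F` together with its first `l` time derivatives is in the class**:
`InB T 0 F = UnifWords T F`, `InB T (l+1) F = InB T l F ∧ InB T l (∂ₜF)`.
[cite: Majda1984, Ch. 2 §2.1, proof of Thm 2.1, Step 3] -/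
def InB (T : ℝ) : ℕ → (ℕ → ℝ → UnitAddTorus ι → X) → Prop
  | 0 => fun F => UnifWords T F
  | l + 1 => fun F => InB T l F ∧ InB T l (fun k => timeDeriv (F k))

namespace InB

variable {T : ℝ}

/-- Level zero. [folklore] -/
@[simp] theorem zero_iff {F : ℕ → ℝ → UnitAddTorus ι → X} : InB T 0 F ↔ UnifWords T F := Iff.rfl

/-- Successor. [folklore] -/
@[simp] theorem succ_iff {l : ℕ} {F : ℕ → ℝ → UnitAddTorus ι → X} :
    InB T (l + 1) F ↔ InB T l F ∧ InB T l (fun k => timeDeriv (F k)) := Iff.rfl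

/-- Members are in the basic class. [folklore] -/
theorem unifWords : ∀ {l : ℕ} {F : ℕ → ℝ → UnitAddTorus ι → X}, InB T l F → UnifWords T F
  | 0, _, h => h
  | _ + 1, _, h => unifWords h.1

/-- Members are jointly smooth. [folklore] -/
theorem smooth {l : ℕ} {F : ℕ → ℝ → UnitAddTorus ι → X} (h : InB T l F) (k : ℕ) :
    IsSmoothSpaceTimeOn univ (F k) := h.unifWords.smooth k

/-- All iterated time derivatives up to the level are in the basic class. [folklore] -/
theorem iterate : ∀ {l : ℕ} {F : ℕ → ℝ → UnitAddTorus ι → X}, InB T l F →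
    ∀ i, i ≤ l → UnifWords T (fun k => (timeDeriv^[i]) (F k))
  | 0, _, h, i, hi => by
    have : i = 0 := by omega
    subst this; exact h
  | l + 1, F, h, i, hi => by
    cases i with
    | zero => exact h.1.unifWords
    | succ i =>
      have := iterate h.2 i (by omega)
      simpa only [Function.iterate_succ, Function.comp] using this

/-- Negation. [folklore] -/
theorem neg : ∀ {l : ℕ} {F : ℕ → ℝ → UnitAddTorus ι → X}, InB T l F → InB T l (fun k t x => -F k t x)
  | 0, _, h => UnifWords.neg h
  | l + 1, F, h => by
    refine ⟨neg h.1, ?_⟩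
    have e : (fun k => timeDeriv (fun t x => -F k t x)) = fun k t x => -timeDeriv (F k) t x :=
      funext fun k => timeDeriv_neg' (F k)
    rw [e]
    exact neg h.2

/-- Sums. [folklore] -/
theorem add : ∀ {l : ℕ} {F F' : ℕ → ℝ → UnitAddTorus ι → X}, InB T l F → InB T l F' →
    InB T l (fun k t x => F k t x + F' k t x)
  | 0, _, _, h, h' => UnifWords.add h h'
  | l + 1, F, F', h, h' => by
    refine ⟨add h.1 h'.1, ?_⟩
    have e : (fun k => timeDeriv (fun t x => F k t x + F' k t x)) =
        fun k t x => timeDeriv (F k) t x + timeDeriv (F' k) t x :=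
      funext fun k => timeDeriv_add' (h.smooth k) (h'.smooth k)
    rw [e]
    exact add h.2 h'.2

/-- Finite sums. [folklore] -/
theorem sum {κ : Type*} (s : Finset κ) : ∀ {l : ℕ} {F : κ → ℕ → ℝ → UnitAddTorus ι → X},
    (∀ i ∈ s, InB T l (F i)) → InB T l (fun k t x => ∑ i ∈ s, F i k t x)
  | 0, _, h => UnifWords.sum s h
  | l + 1, F, h => by
    refine ⟨sum s fun i hi => (h i hi).1, ?_⟩
    have e : (fun k => timeDeriv (fun t x => ∑ i ∈ s, F i k t x)) =
        fun k t x => ∑ i ∈ s, timeDeriv (F i k) t x :=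
      funext fun k => timeDeriv_sum' s fun i hi => (h i hi).smooth k
    rw [e]
    exact sum s fun i hi => (h i hi).2

/-- Spatial derivatives. [folklore] -/
theorem partialDeriv : ∀ {l : ℕ} {F : ℕ → ℝ → UnitAddTorus ι → X}, InB T l F → ∀ j : ι,
    InB T l (fun k t x => Torus.partialDeriv j (F k t) x)
  | 0, _, h, j => UnifWords.partialDeriv h j
  | l + 1, F, h, j => by
    refine ⟨partialDeriv h.1 j, ?_⟩
    have e : (fun k => timeDeriv (fun t x => Torus.partialDeriv j (F k t) x)) =
        fun k t x => Torus.partialDeriv j (timeDeriv (F k) t) x :=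
      funext fun k => timeDeriv_partialDeriv' (h.smooth k) j
    rw [e]
    exact partialDeriv h.2 j

/-- Shifts. [folklore] -/
theorem shift : ∀ {l : ℕ} {F : ℕ → ℝ → UnitAddTorus ι → X}, InB T l F → InB T l (fun k => F (k + 1))
  | 0, _, h => UnifWords.shift h
  | _ + 1, _, h => ⟨shift h.1, shift h.2⟩

/-- Unshifts. [folklore] -/
theorem of_shift : ∀ {l : ℕ} {F : ℕ → ℝ → UnitAddTorus ι → X}, IsSmoothSpaceTimeOn univ (F 0) →
    InB T l (fun k => F (k + 1)) → InB T l F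
  | 0, _, h0, h => UnifWords.of_shift h0 h
  | _ + 1, _, h0, h => ⟨of_shift h0 h.1, of_shift (isSmoothSpaceTimeOn_timeDeriv h0) h.2⟩

/-- **Continuous bilinear pointwise operations** (product rule in time). [folklore] -/
theorem bilin (B : X →L[ℝ] Y →L[ℝ] Z) : ∀ {l : ℕ} {F : ℕ → ℝ → UnitAddTorus ι → X}
    {G : ℕ → ℝ → UnitAddTorus ι → Y}, InB T l F → InB T l G →
    InB T l (fun k t x => B (F k t x) (G k t x))
  | 0, _, _, hF, hG => UnifWords.bilin B hF hG
  | l + 1, F, G, hF, hG => by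
    refine ⟨bilin B hF.1 hG.1, ?_⟩
    have e : (fun k => timeDeriv (fun t x => B (F k t x) (G k t x))) =
        fun k t x => B (timeDeriv (F k) t x) (G k t x) + B (F k t x) (timeDeriv (G k) t x) :=
      funext fun k => timeDeriv_bilin B (hF.smooth k) (hG.smooth k)
    rw [e]
    exact add (bilin B hF.2 hG.1) (bilin B hF.1 hG.2)

/-- **Composition with smooth maps of the values** (chain rule in time; induction over the
level for all target spaces at once). [folklore] -/
theorem comp {W : Type u} [NormedAddCommGroup W] [NormedSpace ℝ W] [FiniteDimensional ℝ W] :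
    ∀ (l : ℕ) {X' : Type u} [NormedAddCommGroup X'] [NormedSpace ℝ X']
      {F : ℕ → ℝ → UnitAddTorus ι → W} {φ : W → X'}, ContDiff ℝ ∞ φ → InB T l F →
      InB T l (fun k t x => φ (F k t x))
  | 0, _, _, _, _, _, hφ, hF => UnifWords.comp hφ hF
  | l + 1, X', _, _, F, φ, hφ, hF => by
    refine ⟨comp l hφ hF.1, ?_⟩
    have e : (fun k => timeDeriv (fun t x => φ (F k t x))) =
        fun k t x => (fderiv ℝ φ (F k t x)) (timeDeriv (F k) t x) :=
      funext fun k => timeDeriv_comp_smooth hφ (hF.smooth k)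
    rw [e]
    have hψ : ContDiff ℝ ∞ (fderiv ℝ φ) := hφ.fderiv_right (m := ∞) (by norm_cast)
    have h1 : InB T l (fun k t x => fderiv ℝ φ (F k t x)) := comp l hψ hF.1
    exact bilin (ContinuousLinearMap.id ℝ (W →L[ℝ] X')) h1 hF.2

end InB

end Literature.Analysis.PDE

end
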